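import Mathlib
import Summits.Ventures.HodgeRepro.Tier4.Target
import Summits.Ventures.HodgeRepro.Tier4.Line3.Defs
import Summits.Ventures.HodgeRepro.Tier4.Line3.LocaliserS
import Summits.Ventures.HodgeRepro.Tier4.Line3.GrowthInvOfMajorant
import Summits.Ventures.HodgeRepro.Tier4.Line3.CoefMajorantWitness
import Summits.Ventures.HodgeRepro.Tier4.Line3.ContentIdeal

/-!
# Tier4/Line3/ContentWitness — `HasCoefMajorant` from a CONTENT BOUND on the theta coefficients

Blind re-derivation cell `pub-hodge-repro`, Tier 4 «PROVE THE STEP» (README §9–§10), LINE L3, lemma L3.5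
`term_dominated`; seat t4-L2-p3 (gen 3).  The last step of the chain p676532 → p676981 → ContentIdeal: the free
factor `κ` of `hasCoefMajorant_of_content` is now `(1 + N(content x))^{e′}`, and the three hypotheses on `κ` become
THEOREMS of the content ideal — only the bound on the coefficients themselves and the depth of the localiser's
representatives remain displayed.

* `abs_norm_eq_prod_norm_emb`: `|N_{E′/ℚ}(a)| = ∏_{σ : E′ → ℂ} ‖σ a‖`;
* `norm_tau_le`: `‖τ₀ (x i)‖ ≤ K_C · ‖y(x)‖` (`τ₀ x = C · y(x)`, `C` the Sylvester matrix);
* `contentNorm_le_arch`: `N(content x) ≤ ((1 + K_C)(1 + ‖y(x)‖))² · defPoly (1/2) x` — the two non-definite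
  embeddings `τ₀, τ̄₀` are controlled by the ball coordinate, the definite ones by `‖σ x_i‖ ≤ (1 + Σ_k ‖σ x_k‖²)^{1/2}`;
* `ContentBound D C e′`: `‖cf j x‖ ≤ C · (1 + N(content x))^{e′} · gaussDef x` — the print's bound on the theta
  coefficients (the local torus averages grow like a power of the content; the exact `H`-Gaussian), a clause on the
  THETA DATA alone (L3.0);
* **`hasCoefMajorant_of_contentBound`**: `ContentBound D C e′ → RepDenom D ℓ → HasCoefMajorant D ℓ`, hence
  **`term_dominated_of_contentBound_lit`**: L3.5's conclusion from `LocSize ℓ`, `RepDenom D ℓ`, `ContentBound D C e′`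
  and `hlit` — every remaining hypothesis is a statement about the localiser's representatives (size, depth) or the
  printed coefficient bound; nothing is quantified over `Γ` or over a free majorant any more.

No printed input is consumed; nothing here asserts anything about the truth of (P); HC_CM is NOT proved by anyone
in this repository.
-/

set_option autoImplicit false

noncomputable section

namespace Summit.Ventures.HodgeRepro.Tier4.Line3

open Summit.Ventures.HodgeRepro.Tier4
open Matrix NumberField
open scoped ComplexConjugate

namespace T4Data

variable (X : T4Data)

/-! ### 1. The absolute norm as a product over the complex embeddings -/

/-- `|N_{E′/ℚ}(a)| = ∏_{σ : E′ →+* ℂ} ‖σ a‖`. -/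
theorem abs_norm_eq_prod_norm_emb (a : X.E) : |Algebra.norm ℚ a| = ∏ σ : X.E →+* ℂ, ‖σ a‖ := by
  have h := Algebra.norm_eq_prod_embeddings ℚ ℂ a
  have h' := congrArg (fun z : ℂ => ‖z‖) h
  simp only [norm_prod] at h'
  have hl : ‖(algebraMap ℚ ℂ) (Algebra.norm ℚ a)‖ = |Algebra.norm ℚ a| := by simp
  rw [hl] at h'
  rw [h']
  exact Fintype.prod_equiv RingHom.equivRatAlgHom.symm _ _ fun φ => rfl

/-! ### 2. The archimedean size of a coordinate: the ball coordinate at `τ₀`, the definite sizes elsewhere -/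

/-- The constant `K_C = Σ_{i,j} ‖C_{ij}‖` of the Sylvester matrix. -/
def sylvesterConst : ℝ := ∑ i, ∑ j, ‖X.C i j‖

/-- `0 ≤ K_C`. -/
theorem sylvesterConst_nonneg : 0 ≤ X.sylvesterConst :=
  Finset.sum_nonneg fun _ _ => Finset.sum_nonneg fun _ _ => norm_nonneg _

/-- `τ₀(x) = C · y(x)`: the ball coordinate inverts the Sylvester matrix. -/
theorem tau_eq_sylvester_mulVec_ballCoord (x : Fin 3 → X.E) : (fun i => X.τ₀ (x i)) = X.C *ᵥ X.ballCoord x := by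
  unfold ballCoord
  rw [Matrix.mulVec_mulVec, Matrix.mul_nonsing_inv _ ((Matrix.isUnit_iff_isUnit_det _).mp X.hC.1),
    Matrix.one_mulVec]

/-- **The `τ₀`-size of a coordinate is controlled by the ball coordinate**: `‖τ₀ (x i)‖ ≤ K_C · ‖y(x)‖`. -/
theorem norm_tau_le (x : Fin 3 → X.E) (i : Fin 3) : ‖X.τ₀ (x i)‖ ≤ X.sylvesterConst * ‖X.ballCoord x‖ := by
  have h : X.τ₀ (x i) = (X.C *ᵥ X.ballCoord x) i := congrFun (X.tau_eq_sylvester_mulVec_ballCoord x) i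
  rw [h]
  simp only [Matrix.mulVec, dotProduct]
  calc ‖∑ j, X.C i j * X.ballCoord x j‖ ≤ ∑ j, ‖X.C i j * X.ballCoord x j‖ := norm_sum_le _ _
    _ ≤ ∑ j, ‖X.C i j‖ * ‖X.ballCoord x‖ := by
        refine Finset.sum_le_sum fun j _ => ?_
        rw [norm_mul]
        exact mul_le_mul_of_nonneg_left (norm_le_pi_norm _ j) (norm_nonneg _)
    _ = (∑ j, ‖X.C i j‖) * ‖X.ballCoord x‖ := by rw [Finset.sum_mul]
    _ ≤ X.sylvesterConst * ‖X.ballCoord x‖ := by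
        refine mul_le_mul_of_nonneg_right ?_ (norm_nonneg _)
        exact Finset.single_le_sum (f := fun i => ∑ j, ‖X.C i j‖)
          (fun _ _ => Finset.sum_nonneg fun _ _ => norm_nonneg _) (Finset.mem_univ i)

/-- At a non-definite embedding (`τ₀` or `τ̄₀`) the size of `a` is its `τ₀`-size. -/
theorem norm_emb_eq_of_not_def (σ : X.E →+* ℂ) (hσ : ¬(σ ≠ X.τ₀ ∧ σ ≠ conjEmb X.τ₀)) (a : X.E) :
    ‖σ a‖ = ‖X.τ₀ a‖ := by
  by_cases h1 : σ = X.τ₀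
  · rw [h1]
  · have h2 : σ = conjEmb X.τ₀ := by
      by_contra h2
      exact hσ ⟨h1, h2⟩
    rw [h2]
    simp only [conjEmb, RingHom.comp_apply]
    exact Complex.norm_conj _

/-- At a definite embedding, `‖σ (x i)‖ ≤ (1 + Σ_k ‖σ (x k)‖²)^{1/2}`. -/
theorem norm_emb_le_sqrt (σ : X.E →+* ℂ) (x : Fin 3 → X.E) (i : Fin 3) :
    ‖σ (x i)‖ ≤ (1 + ∑ k, ‖σ (x k)‖ ^ 2) ^ ((1 : ℝ) / 2) := by
  rw [← Real.sqrt_eq_rpow]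
  have hs : 0 ≤ ∑ k, ‖σ (x k)‖ ^ 2 := Finset.sum_nonneg fun _ _ => by positivity
  rw [Real.le_sqrt (norm_nonneg _) (by linarith)]
  have : ‖σ (x i)‖ ^ 2 ≤ ∑ k, ‖σ (x k)‖ ^ 2 :=
    Finset.single_le_sum (f := fun k => ‖σ (x k)‖ ^ 2) (fun _ _ => by positivity) (Finset.mem_univ i)
  linarith

open scoped Classical in
/-- The non-definite embeddings are at most two (`τ₀` and `τ̄₀`). -/
theorem card_not_def_le_two :
    (Finset.univ.filter fun σ : X.E →+* ℂ => ¬(σ ≠ X.τ₀ ∧ σ ≠ conjEmb X.τ₀)).card ≤ 2 := by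
  have hsub : (Finset.univ.filter fun σ : X.E →+* ℂ => ¬(σ ≠ X.τ₀ ∧ σ ≠ conjEmb X.τ₀)) ⊆
      {X.τ₀, conjEmb X.τ₀} := by
    intro σ hσ
    rw [Finset.mem_filter] at hσ
    rw [Finset.mem_insert, Finset.mem_singleton]
    by_contra h
    exact hσ.2 ⟨fun h1 => h (Or.inl h1), fun h2 => h (Or.inr h2)⟩
  exact (Finset.card_le_card hsub).trans (Finset.card_le_two)

/-- **The norm of a coordinate against the ball coordinate and the definite sizes**:
`|N(x_i)| ≤ ((1 + K_C)(1 + ‖y(x)‖))² · defPoly (1/2) x`. -/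
theorem abs_norm_coord_le (x : Fin 3 → X.E) (i : Fin 3) :
    |Algebra.norm ℚ (x i)| ≤ ((1 + X.sylvesterConst) * (1 + ‖X.ballCoord x‖)) ^ 2 * X.defPoly ((1 : ℝ) / 2) x := by
  classical
  rw [X.abs_norm_eq_prod_norm_emb, X.defPoly_eq_prod,
    ← Finset.prod_filter_mul_prod_filter_not Finset.univ (fun σ : X.E →+* ℂ => σ ≠ X.τ₀ ∧ σ ≠ conjEmb X.τ₀)]
  set b : ℝ := (1 + X.sylvesterConst) * (1 + ‖X.ballCoord x‖) with hb
  have hb1 : 1 ≤ b := by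
    rw [hb]
    have h1 : 1 ≤ 1 + X.sylvesterConst := by linarith [X.sylvesterConst_nonneg]
    have h2 : 1 ≤ 1 + ‖X.ballCoord x‖ := by linarith [norm_nonneg (X.ballCoord x)]
    nlinarith
  -- the definite part
  have hdef : ∏ σ ∈ Finset.univ.filter (fun σ : X.E →+* ℂ => σ ≠ X.τ₀ ∧ σ ≠ conjEmb X.τ₀), ‖σ (x i)‖ ≤
      ∏ σ ∈ Finset.univ.filter (fun σ : X.E →+* ℂ => σ ≠ X.τ₀ ∧ σ ≠ conjEmb X.τ₀),
        (1 + ∑ k, ‖σ (x k)‖ ^ 2) ^ ((1 : ℝ) / 2) :=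
    Finset.prod_le_prod (fun _ _ => norm_nonneg _) fun σ _ => X.norm_emb_le_sqrt σ x i
  -- the non-definite part
  have hnd : ∏ σ ∈ Finset.univ.filter (fun σ : X.E →+* ℂ => ¬(σ ≠ X.τ₀ ∧ σ ≠ conjEmb X.τ₀)), ‖σ (x i)‖ ≤
      b ^ 2 := by
    calc ∏ σ ∈ Finset.univ.filter (fun σ : X.E →+* ℂ => ¬(σ ≠ X.τ₀ ∧ σ ≠ conjEmb X.τ₀)), ‖σ (x i)‖
        ≤ ∏ _σ ∈ Finset.univ.filter (fun σ : X.E →+* ℂ => ¬(σ ≠ X.τ₀ ∧ σ ≠ conjEmb X.τ₀)), b := by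
          refine Finset.prod_le_prod (fun _ _ => norm_nonneg _) fun σ hσ => ?_
          rw [Finset.mem_filter] at hσ
          rw [X.norm_emb_eq_of_not_def σ hσ.2]
          calc ‖X.τ₀ (x i)‖ ≤ X.sylvesterConst * ‖X.ballCoord x‖ := X.norm_tau_le x i
            _ ≤ b := by
                rw [hb]
                nlinarith [X.sylvesterConst_nonneg, norm_nonneg (X.ballCoord x)]
      _ = b ^ (Finset.univ.filter fun σ : X.E →+* ℂ => ¬(σ ≠ X.τ₀ ∧ σ ≠ conjEmb X.τ₀)).card :=
          Finset.prod_const b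
      _ ≤ b ^ 2 := pow_le_pow_right₀ hb1 X.card_not_def_le_two
  have h0 : 0 ≤ ∏ σ ∈ Finset.univ.filter (fun σ : X.E →+* ℂ => σ ≠ X.τ₀ ∧ σ ≠ conjEmb X.τ₀), ‖σ (x i)‖ :=
    Finset.prod_nonneg fun _ _ => norm_nonneg _
  have hP0 : 0 ≤ ∏ σ ∈ Finset.univ.filter (fun σ : X.E →+* ℂ => σ ≠ X.τ₀ ∧ σ ≠ conjEmb X.τ₀),
      (1 + ∑ k, ‖σ (x k)‖ ^ 2) ^ ((1 : ℝ) / 2) :=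
    Finset.prod_nonneg fun _ _ => Real.rpow_nonneg (by positivity) _
  calc (∏ σ ∈ Finset.univ.filter (fun σ : X.E →+* ℂ => σ ≠ X.τ₀ ∧ σ ≠ conjEmb X.τ₀), ‖σ (x i)‖) *
        ∏ σ ∈ Finset.univ.filter (fun σ : X.E →+* ℂ => ¬(σ ≠ X.τ₀ ∧ σ ≠ conjEmb X.τ₀)), ‖σ (x i)‖
      ≤ (∏ σ ∈ Finset.univ.filter (fun σ : X.E →+* ℂ => σ ≠ X.τ₀ ∧ σ ≠ conjEmb X.τ₀),
          (1 + ∑ k, ‖σ (x k)‖ ^ 2) ^ ((1 : ℝ) / 2)) * b ^ 2 :=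
        mul_le_mul hdef hnd (Finset.prod_nonneg fun _ _ => norm_nonneg _) hP0
    _ = b ^ 2 * ∏ σ ∈ Finset.univ.filter (fun σ : X.E →+* ℂ => σ ≠ X.τ₀ ∧ σ ≠ conjEmb X.τ₀),
          (1 + ∑ k, ‖σ (x k)‖ ^ 2) ^ ((1 : ℝ) / 2) := mul_comm _ _

/-- `1 ≤ defPoly e′ x` for `e′ ≥ 0`. -/
theorem one_le_defPoly {e' : ℝ} (he' : 0 ≤ e') (x : Fin 3 → X.E) : 1 ≤ X.defPoly e' x := by
  classical
  rw [X.defPoly_eq_prod]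
  calc (1 : ℝ) = ∏ _σ ∈ Finset.univ.filter (fun σ : X.E →+* ℂ => σ ≠ X.τ₀ ∧ σ ≠ conjEmb X.τ₀), (1 : ℝ) :=
        Finset.prod_const_one.symm
    _ ≤ _ := by
        refine Finset.prod_le_prod (fun _ _ => zero_le_one) fun σ _ => Real.one_le_rpow ?_ he'
        have : 0 ≤ ∑ k, ‖σ (x k)‖ ^ 2 := Finset.sum_nonneg fun _ _ => by positivity
        linarith

/-- **The content norm against the ball coordinate and the definite sizes**:
`N(content x) ≤ ((1 + K_C)(1 + ‖y(x)‖))² · defPoly (1/2) x` for every `x`. -/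
theorem contentNorm_le_arch (x : Fin 3 → X.E) :
    X.contentNorm x ≤ ((1 + X.sylvesterConst) * (1 + ‖X.ballCoord x‖)) ^ 2 * X.defPoly ((1 : ℝ) / 2) x := by
  by_cases hx : x = 0
  · subst hx
    have hc : X.content 0 = 0 := FractionalIdeal.spanFinset_eq_zero.mpr (fun _ _ => rfl)
    have h0 : X.contentNorm 0 = 0 := by
      unfold contentNorm
      rw [hc, map_zero, Rat.cast_zero]
    rw [h0]
    exact mul_nonneg (by positivity) (X.defPoly_nonneg _ _)
  · obtain ⟨i, hi⟩ := Function.ne_iff.mp hx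
    exact (X.contentNorm_le_abs_norm_coord x i hi).trans (X.abs_norm_coord_le x i)

/-! ### 3. The content bound on the theta coefficients, and the witness -/

/-- **THE CONTENT BOUND** on the theta coefficients (a clause on the theta data alone, L3.0):
`‖cf j x‖ ≤ C · (1 + N(content x))^{e′} · gaussDef x` — the local torus averages of lattice indicators grow like a
power of the content, times the exact `H`-Gaussian of the definite places. -/
def ContentBound (D : X.ThetaData) (C e' : ℝ) : Prop :=
  ∀ j x, ‖D.cf j x‖ ≤ C * (1 + X.contentNorm x) ^ e' * X.gaussDef x

/-- `defPoly` and real powers: `(defPoly a x)^b = defPoly (a b) x`. -/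
theorem defPoly_rpow (a b : ℝ) (x : Fin 3 → X.E) : X.defPoly a x ^ b = X.defPoly (a * b) x := by
  classical
  rw [X.defPoly_eq_prod, X.defPoly_eq_prod,
    ← Real.finsetProd_rpow _ _ (fun σ _ => Real.rpow_nonneg (by positivity) _)]
  exact Finset.prod_congr rfl fun σ _ => (Real.rpow_mul (by positivity) _ _).symm

/-- **`κ = (1 + N(content))^{e′}` grows at most geometrically under the localiser's representatives**, with the
ratio `N(𝔭 𝔭̄)^{e′}` per unit of depth. -/
theorem kappa_mulVec_le_of_repDenom (D : X.ThetaData)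
    {p : IsDedekindDomain.HeightOneSpectrum (RingOfIntegers X.E)}
    {L₀ : Submodule (RingOfIntegers X.E) (Fin 3 → X.E)} {xm : X.Tuple} (ℓ : X.LocS D p L₀ xm)
    (hrep : X.RepDenom D ℓ) {e' : ℝ} (he' : 0 ≤ e') (N : ℕ) (r : Matrix (Fin 3) (Fin 3) X.E)
    (hr : X.IsRepOf (ℓ.loc N) r) (x : Fin 3 → X.E) :
    (1 + X.contentNorm (r *ᵥ x)) ^ e' ≤
      ((Ideal.absNorm (p.asIdeal * X.conjIdeal p.asIdeal) : ℝ) ^ e') ^ N * (1 + X.contentNorm x) ^ e' := by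
  set q : ℝ := (Ideal.absNorm (p.asIdeal * X.conjIdeal p.asIdeal) : ℝ) with hq
  have hq1 : 1 ≤ q := X.one_le_absNorm_depthPrime p
  have hq0 : 0 ≤ q := zero_le_one.trans hq1
  have hqN : 1 ≤ q ^ N := one_le_pow₀ hq1
  have hc := X.contentNorm_mulVec_le_of_repDenom D ℓ hrep N r hr x
  have hc0 := X.contentNorm_nonneg x
  have h1 : 1 + X.contentNorm (r *ᵥ x) ≤ q ^ N * (1 + X.contentNorm x) := by
    rw [← hq] at hc
    nlinarith
  calc (1 + X.contentNorm (r *ᵥ x)) ^ e' ≤ (q ^ N * (1 + X.contentNorm x)) ^ e' :=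
        Real.rpow_le_rpow (by linarith [X.contentNorm_nonneg (r *ᵥ x)]) h1 he'
    _ = (q ^ N) ^ e' * (1 + X.contentNorm x) ^ e' := Real.mul_rpow (by positivity) (by linarith)
    _ = (q ^ e') ^ N * (1 + X.contentNorm x) ^ e' := by
        congr 1
        rw [← Real.rpow_natCast q N, ← Real.rpow_mul hq0, ← Real.rpow_natCast (q ^ e') N,
          ← Real.rpow_mul hq0, mul_comm]

/-- **`κ = (1 + N(content))^{e′}` is of polynomial size**: `κ x ≤ A · (1 + ‖y(x)‖)^{2e′} · defPoly (e′/2) x`. -/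
theorem kappa_le_poly {e' : ℝ} (he' : 0 ≤ e') (x : Fin 3 → X.E) :
    (1 + X.contentNorm x) ^ e' ≤
      (1 + (1 + X.sylvesterConst) ^ 2) ^ e' * (1 + ‖X.ballCoord x‖) ^ (2 * e') * X.defPoly (e' / 2) x := by
  set B : ℝ := (1 + X.sylvesterConst) ^ 2 with hB
  set Y : ℝ := (1 + ‖X.ballCoord x‖) ^ 2 with hY
  set P : ℝ := X.defPoly ((1 : ℝ) / 2) x with hP
  have hB0 : 0 ≤ B := by positivity
  have hY1 : 1 ≤ Y := by
    rw [hY]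
    have : 1 ≤ 1 + ‖X.ballCoord x‖ := by linarith [norm_nonneg (X.ballCoord x)]
    nlinarith
  have hP1 : 1 ≤ P := X.one_le_defPoly (by norm_num) x
  have harch : X.contentNorm x ≤ B * Y * P := by
    have := X.contentNorm_le_arch x
    rw [mul_pow] at this
    exact this
  have h1 : 1 + X.contentNorm x ≤ (1 + B) * Y * P := by
    have hYP : 1 ≤ Y * P := one_le_mul_of_one_le_of_one_le hY1 hP1
    nlinarith
  have hc0 := X.contentNorm_nonneg x
  calc (1 + X.contentNorm x) ^ e' ≤ ((1 + B) * Y * P) ^ e' :=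
        Real.rpow_le_rpow (by linarith) h1 he'
    _ = (1 + B) ^ e' * Y ^ e' * P ^ e' := by
        rw [Real.mul_rpow (by positivity) (by linarith), Real.mul_rpow (by positivity) (by linarith)]
    _ = (1 + B) ^ e' * (1 + ‖X.ballCoord x‖) ^ (2 * e') * X.defPoly (e' / 2) x := by
        rw [hY, hP, ← Real.rpow_natCast (1 + ‖X.ballCoord x‖) 2, ← Real.rpow_mul (by positivity),
          X.defPoly_rpow, show (1 : ℝ) / 2 * e' = e' / 2 by ring]
        norm_num

/-- **THE WITNESS FROM THE CONTENT BOUND AND THE DEPTH CLAUSE**: `ContentBound D C e′ → RepDenom D ℓ →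
HasCoefMajorant D ℓ`, with `κ = (1 + N(content x))^{e′}`. -/
theorem hasCoefMajorant_of_contentBound (D : X.ThetaData)
    {p : IsDedekindDomain.HeightOneSpectrum (RingOfIntegers X.E)}
    {L₀ : Submodule (RingOfIntegers X.E) (Fin 3 → X.E)} {xm : X.Tuple} (ℓ : X.LocS D p L₀ xm)
    {C e' : ℝ} (hC : 0 ≤ C) (he' : 0 ≤ e') (hcf : X.ContentBound D C e') (hrep : X.RepDenom D ℓ) :
    X.HasCoefMajorant D ℓ := by
  have hq0 : 0 ≤ (Ideal.absNorm (p.asIdeal * X.conjIdeal p.asIdeal) : ℝ) :=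
    zero_le_one.trans (X.one_le_absNorm_depthPrime p)
  refine X.hasCoefMajorant_of_content D ℓ (fun x => (1 + X.contentNorm x) ^ e')
    (C := C) (q₃ := (Ideal.absNorm (p.asIdeal * X.conjIdeal p.asIdeal) : ℝ) ^ e')
    (A := (1 + (1 + X.sylvesterConst) ^ 2) ^ e') (e := 2 * e') (e' := e' / 2)
    hC (Real.rpow_nonneg hq0 _) (Real.rpow_nonneg (by positivity) _) (by positivity)
    (fun x => Real.rpow_nonneg (by linarith [X.contentNorm_nonneg x]) _) (fun j x => hcf j x)
    (fun γ hγ x => ?_) (fun N r hr x => X.kappa_mulVec_le_of_repDenom D ℓ hrep he' N r hr x)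
    (fun x => X.kappa_le_poly he' x)
  simp only [X.contentNorm_mulVec_eq_of_mem_Γ hγ x]

/-- **L3.5 FROM THE SIZE AND DEPTH OF THE LOCALISER, THE CONTENT BOUND AND `hlit`**: every remaining hypothesis is a
statement about the localiser's representatives (`LocSize`, `RepDenom`), the printed coefficient bound
(`ContentBound`) or the fundamental domain (`hlit`). -/
theorem term_dominated_of_contentBound_lit (D : X.ThetaData)
    (p : IsDedekindDomain.HeightOneSpectrum (RingOfIntegers X.E))
    (L₀ : Submodule (RingOfIntegers X.E) (Fin 3 → X.E)) (xm : X.Tuple)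
    (h02 : xm 2 = xm 0) (h13 : xm 3 = xm 1) (hab : LinearIndependent X.E ![xm 0, xm 1]) (ℓ : X.LocS D p L₀ xm)
    (hsize : X.LocSize D ℓ) (hrep : X.RepDenom D ℓ)
    {C e' : ℝ} (hC : 0 ≤ C) (he' : 0 ≤ e') (hcf : X.ContentBound D C e')
    (hlit : Lit.BorelHarishChandra1962_Thm11_8_fundamentalDomain_hdef X.E X.H X.τ₀ X.C) :
    ∃ bound : X.Orbit → ℝ, (∀ o, 0 ≤ bound o) ∧ Summable bound ∧
      ∀ N (o : X.Orbit), o ≠ X.orbitOf (X.lines xm) →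
        ‖X.term D.Φ D.cf (ℓ.level N) (ℓ.loc N) o‖ ≤ bound o :=
  X.term_dominated_of_coefMajorant_lit D p L₀ xm h02 h13 hab ℓ hsize
    (X.hasCoefMajorant_of_contentBound D ℓ hC he' hcf hrep) hlit

end T4Data

end Summit.Ventures.HodgeRepro.Tier4.Line3

end
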